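import Literature.Computability.QuantumComplexity.BQP
import Literature.Computability.Cryptography.ClassBQPAmplificationProofs
import HarnessLib

/-!
# Robustness of `BQP`, error reduction (quantum-advantage.S26) — discharge of `BQPWith_eq_BQP`

Sibling proof file of `QuantumComplexity/BQP.lean` (D-0014: the named fact stays a `def`; this file
lands `BQPWith_eq_BQP_holds`). The statement file records the inventory item quantum-advantage.S26
(error reduction) as the named fact
`Literature.Computability.QuantumComplexity.BQPWith_eq_BQP : ∀ {ε}, 0 < ε → ε < 1/2 → BQPWith cliffordT ε = BQP`,
which is, binder for binder, the prelude fact `Literature.Computability.Cryptography.BQP_eq_BQPWith`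
of `Cryptography/ClassBQP.lean` (the interim proof text `BQP_eq_BQPWith h0 h` is preserved in
`BQP.lean`). That prelude fact is now a theorem of the tree,
`Literature.Computability.Cryptography.BQP_eq_BQPWith_holds` (`Cryptography/ClassBQPAmplificationProofs.lean`:
majority vote over parallel copies, Bennett–Bernstein–Brassard–Vazirani 1997, Thm. 4.13, through
`QuantumComplexity/BQPMajorityAmplification.lean`), so S26's error-reduction half is discharged by
instantiation. Nothing else is in this file; the gate-set-independence half `BQPOver_eq_BQP`
(Solovay–Kitaev) remains a named fact.

## References

* E. Bernstein, U. Vazirani, *Quantum complexity theory*, SIAM J. Comput. 26 (1997) 1411–1473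
  [BernsteinVazirani1997], §8.2, Thm. 8.5 (error reduction for `BQTime`).
* C. H. Bennett, E. Bernstein, G. Brassard, U. Vazirani, *Strengths and weaknesses of quantum
  computing*, SIAM J. Comput. 26 (1997) 1510–1523 [BennettBernsteinBrassardVazirani1997], Thm. 4.13
  (majority vote over `k` copies).
* J. Watrous, *Quantum computational complexity*, Encyclopedia of Complexity and Systems Science
  (2009) [Watrous2009], §III.1 (`BQP = BQP(a, b)` for constants).
-/

namespace Literature.Computability.QuantumComplexity

open Literature.Computability.Cryptography

/-- **quantum-advantage.S26 (error reduction), discharged**: for every constant `0 < ε < 1/2`,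
`BQPWith cliffordT ε = BQP` — the named fact `BQPWith_eq_BQP` of `BQP.lean` holds, by the tree
theorem `Literature.Computability.Cryptography.BQP_eq_BQPWith_holds` (same statement under the
prelude name). [cite: BernsteinVazirani1997, §8.2 Thm. 8.5] [cite: BennettBernsteinBrassardVazirani1997, Thm. 4.13] -/
theorem BQPWith_eq_BQP_holds : BQPWith_eq_BQP := fun h0 h =>
  BQP_eq_BQPWith_holds h0 h

end Literature.Computability.QuantumComplexity
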